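import Summits.HodgeConjecture.HodgeConjecture.Theorems.PadicSemiregularLiftHodgeFermatVarietiesLevelRaise
import Summits.HodgeConjecture.HodgeConjecture.Theorems.PadicSemiregularLiftHodgeFermatVarietiesLatticeCriterion
import Summits.HodgeConjecture.HodgeConjecture.Theorems.PadicSemiregularLiftHodgeFermatVarietiesSigmaTwo
import HarnessLib

/-!
# Residues of `ℤ/2M`, halving of even residues, norm bookkeeping — toolkit for the doubling lemma of line `cancel-by-any-claim-lattice`, crux `HodgeFermatVarieties` (stmt-HodgeConjecture-1334)

Toolkit file (everything PROVED, elementary) for stub S10 `stub_doubleDecomposition` of skeleton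
generation 10 (lead c3), whose statement and proof live in the sibling file `…Doubling`; recorded here so
that both files stay under the 400-line limit. Contents: §1 parities of representatives in `ℤ/2M` (the element `M̄ = M mod 2M` of order two,
`-M̄ = M̄`, `T M̄ = M̄` for units `T`, `2x ≠ 0` off `{0, M̄}` are REUSED from the sibling `…SigmaTwo`,
namespace `SigmaTwo`); §2 the halving map `x ↦ ⟨x⟩/2 mod M` on even residues, a
right inverse of level raising by `2` (`levelRaise_map_halfRes`); §3 norm bookkeeping (`2‖TΣQ‖ = m#ΣQ` for
families of Hodge multisets, `‖-X‖ + ‖X‖ = m#X`, the norm of copies of `M̄`, pairs are Hodge).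

THE DOUBLING LEMMA these serve (sibling file): For `M` odd and a Hodge
multiset `s` of `ℤ/2M` (Shioda's `M_{2M}`): there are finite families `P`, `N` of elements of the
printed supply of level `2M` and zero-free multisets `v`, `w` of `ℤ/M`, with `w + (-v)` a Hodge
multiset of level `M` (or empty) and `#w + #v ≤ 2 #s`, such that

    s + ΣN + 2•v = ΣP + 2•w            (`2•` = level raising `LevelRaise[2, M, ·]`).

CONSTRUCTION. Split `s = s_ev + s_od + c•{M̄}` into its even residues, its odd residues `≠ M̄`
(`M̄ = M mod 2M`, the unique element of order `2`), and `c` copies of `M̄`. For `x ∈ s_od` the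
Fermat-surface class `σ_{2,x} = (x, x + M̄, -2x, M̄)` (Aoki's `2`-standard element, a Hodge
multiset with four elements, stub S9) and the pair `{2x, -2x}` give the multiset identity

    s + D⁻ + Σ_x {2x, -2x} + #s_od • {M̄} = D⁺ + Σ_x σ_{2,x} + c • {M̄},
    D⁺ = s_ev + Σ_x {2x},   D⁻ = Σ_x {x + M̄},

in which `D⁺`, `D⁻` consist of EVEN non-zero residues (`M` odd: `x + M̄` is even), i.e. are the
doubles of zero-free multisets `w`, `v` of `ℤ/M`. Comparing `2Σ⟨T·⟩` of both sides for a unit `T`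
of `ℤ/2M` (every term except `D±` is a Hodge multiset, and `T M̄ = M̄` has representative `M`) gives
`2‖T D⁺‖ + 2M #D⁻ = 2‖T D⁻‖ + 2M #D⁺`; every unit `τ` of `ℤ/M` lifts to a unit `T` of `ℤ/2M`
(`ZMod.unitsMap_surjective`) and `⟨T(2y)⟩_{2M} = 2⟨τ y⟩_M` (`mNormSum_map_mul_levelRaise`, landed), so
`2‖τw‖ + M #v = 2‖τv‖ + M #w`, which says exactly that `u = w + (-v)` satisfies Shioda's norm
equations; at `τ = 1` it gives `2Σw = 2Σv` in `ℤ/M`, hence `Σu = 0` (`2` is a unit, `M` odd), and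
`M(#w - #v)` even, hence `#s_ev` even; as `#s` is even, `c - #s_od` is even and the residual copies of
`{M̄}` group into pairs `{M̄, M̄} = {M̄, -M̄}`. This is the summand `δ = [ord₂ m = 1]` of Yamamoto's
gap-group formula (Aoki 2002 Thm 3.1: `B_m/S_m ≅ (ℤ/2)^{2^{r-1}-1-δ}`) made constructive.

References: [Aoki1987] J. Math. Soc. Japan 39 (1987) §1 p. 387 (`σ_{2,i}`); [Aoki2002] N. Aoki,
Comment. Math. Univ. St. Pauli 51 (2002), Thm 3.1; [Shioda1979PJA] Proc. Japan Acad. 55A (1979) §1.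
-/

set_option linter.dupNamespace false

noncomputable section

open Finset
open Literature.AlgebraicGeometry.HodgeTheory Literature.AlgebraicGeometry.HodgeTheory.FermatCharacter

namespace Summit.HodgeConjecture.HodgeConjecture.Theorems.CancelByAnyClaimLattice.Doubling

/-- `Supply[M]` — the printed supply of level `M` (local notation of the line, verbatim). -/
local notation3 (prettyPrint := false) "Supply[" M "]" =>
  ({s : Multiset (ZMod M) | ∃ a : ZMod M, a ≠ 0 ∧ s = ({a, -a} : Multiset (ZMod M))} ∪
    {s : Multiset (ZMod M) | IsHodgeMultiset s ∧ Multiset.card s = 4} ∪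
    {s : Multiset (ZMod M) | IsHodgeMultiset s ∧ IsSemiDecomposable s} ∪
    {s : Multiset (ZMod M) | ∃ (p : ℕ) (a : ZMod M), p.Prime ∧ p ≠ 2 ∧ p ∣ M ∧
        2 < (M / p) / Nat.gcd (ZMod.val a) (M / p) ∧
        s = Multiset.map (fun j : ℕ => a + (j : ZMod M) * ((M / p : ℕ) : ZMod M)) (Multiset.range p) +
              {-((p : ZMod M) * a)}} : Set (Multiset (ZMod M)))

/-- `Reach[M, s]` (local notation of the line, verbatim). -/
local notation3 (prettyPrint := false) "Reach[" M ", " s "]" =>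
  ∃ P N : Multiset (Multiset (ZMod M)),
    (∀ u ∈ P, u ∈ Supply[M]) ∧ (∀ u ∈ N, u ∈ Supply[M]) ∧ s + Multiset.sum N = Multiset.sum P

/-- `LevelRaise[k, m, s]` (local notation of the line, verbatim). -/
local notation3 (prettyPrint := false) "LevelRaise[" k ", " m ", " s "]" =>
  Multiset.map (fun a : ZMod m => ((k * ZMod.val a : ℕ) : ZMod (k * m))) s

/-- `StableReach[m, s]` (local notation of the line, verbatim). -/
local notation3 (prettyPrint := false) "StableReach[" m ", " s "]" => ∃ k : ℕ, 0 < k ∧ Reach[k * m, LevelRaise[k, m, s]]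

/-- `Half[M, x]` — the residue `⟨x⟩/2 mod M` (meaningful for an even residue `x` of `ℤ/2M`:
then `2 • Half[M, x] = x`). Local notation only. -/
local notation3 (prettyPrint := false) "Half[" M ", " x "]" => (((ZMod.val x) / 2 : ℕ) : ZMod M)

variable {M : ℕ}

/-! ### §1 Residues of `ℤ/2M` (complements to `…SigmaTwo`) -/

open SigmaTwo in
/-- A residue of odd representative is non-zero. [folklore] -/
theorem ne_zero_of_odd_val {x : ZMod (2 * M)} (hx : ¬ 2 ∣ x.val) : x ≠ 0 := by
  rintro rfl
  exact hx (by rw [ZMod.val_zero]; exact dvd_zero 2)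

/-- For `M` odd, adding `M̄` flips the parity of the representative. [folklore] -/
theorem two_dvd_val_add_half_iff [NeZero M] (hMo : Odd M) (x : ZMod (2 * M)) :
    2 ∣ (x + (M : ZMod (2 * M))).val ↔ ¬ 2 ∣ x.val := by
  haveI : NeZero (2 * M) := ⟨by have := NeZero.ne M; omega⟩
  rw [ZMod.val_add, SigmaTwo.val_natCast_half, Nat.dvd_mod_iff (dvd_mul_right 2 M)]
  rcases hMo with ⟨k, rfl⟩
  omega

/-! ### §2 Halving even residues -/

/-- `⟨Half x⟩ = ⟨x⟩/2`. [folklore] -/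
theorem val_halfRes [NeZero M] (x : ZMod (2 * M)) : (Half[M, x]).val = x.val / 2 := by
  haveI : NeZero (2 * M) := ⟨by have := NeZero.ne M; omega⟩
  rw [ZMod.val_natCast, Nat.mod_eq_of_lt]
  have := ZMod.val_lt x
  omega

/-- `2 • Half x = x` for an even residue `x`. [folklore] -/
theorem levelRaise_halfRes [NeZero M] {x : ZMod (2 * M)} (hx : 2 ∣ x.val) :
    ((2 * ZMod.val (Half[M, x]) : ℕ) : ZMod (2 * M)) = x := by
  haveI : NeZero (2 * M) := ⟨by have := NeZero.ne M; omega⟩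
  rw [val_halfRes, Nat.mul_div_cancel' hx, ZMod.natCast_zmod_val]

/-- Level raising by `2` of the halves of a multiset of even residues gives the multiset back. [folklore] -/
theorem levelRaise_map_halfRes : ∀ {M : ℕ} [NeZero M] (X : Multiset (ZMod (2 * M))), (∀ x ∈ X, 2 ∣ x.val) → LevelRaise[2, M, X.map (fun x ↦ (((ZMod.val x) / 2 : ℕ) : ZMod M))] = X := by
  intro M _ X hX
  rw [Multiset.map_map]
  conv_rhs => rw [← Multiset.map_id X]
  refine Multiset.map_congr rfl fun x hx ↦ ?_
  simp only [Function.comp_apply, id_eq]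
  exact levelRaise_halfRes (hX x hx)

/-- The half of a non-zero even residue is non-zero. [folklore] -/
theorem halfRes_ne_zero [NeZero M] {x : ZMod (2 * M)} (hx : 2 ∣ x.val) (h0 : x ≠ 0) : Half[M, x] ≠ 0 := by
  intro h
  apply h0
  rw [← levelRaise_halfRes hx, h, ZMod.val_zero, mul_zero, Nat.cast_zero]

/-! ### §3 Norm bookkeeping -/

/-- `2‖T ΣQ‖ = m #ΣQ` for a family `Q` of Hodge multisets. [cite: Shioda1979PJA, §1 eq. (2)] -/
theorem two_mul_mNormSum_sum {m : ℕ} [NeZero m] (T : (ZMod m)ˣ) (Q : Multiset (Multiset (ZMod m)))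
    (hQ : ∀ u ∈ Q, IsHodgeMultiset u) :
    2 * mNormSum (Q.sum.map fun a ↦ (T : ZMod m) * a) = m * Multiset.card Q.sum :=
  (latticeCriterion_isHodgeMultiset_sum hQ).2 T

/-- `‖-X‖ + ‖X‖ = m #X` for a zero-free multiset `X`. [folklore] -/
theorem mNormSum_map_neg_add {m : ℕ} [NeZero m] (X : Multiset (ZMod m)) (hX : ∀ x ∈ X, x ≠ 0) :
    mNormSum (X.map fun x ↦ -x) + mNormSum X = m * Multiset.card X := by
  induction X using Multiset.induction_on with
  | empty => simp [mNormSum]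
  | cons a X ih =>
    have ha : a ≠ 0 := hX a (Multiset.mem_cons_self a X)
    have ih' := ih fun x hx ↦ hX x (Multiset.mem_cons_of_mem hx)
    rw [Multiset.map_cons, mNormSum_cons, mNormSum_cons, Multiset.card_cons]
    have := val_add_val_neg ha
    nlinarith [this, ih']

/-- The norm of `c` copies of `M̄` under a unit `T` is `c M`. [folklore] -/
theorem mNormSum_replicate_half [NeZero M] (T : (ZMod (2 * M))ˣ) (c : ℕ) :
    mNormSum ((Multiset.replicate c (M : ZMod (2 * M))).map fun a ↦ (T : ZMod (2 * M)) * a) = c * M := by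
  rw [Multiset.map_replicate, SigmaTwo.unit_mul_natCast_half]
  unfold mNormSum
  rw [Multiset.map_replicate, Multiset.sum_replicate, SigmaTwo.val_natCast_half, smul_eq_mul]

/-- A pair `{a, -a}` with `a ≠ 0` is a Hodge multiset. [cite: Shioda1979PJA, §1 (elements of length 1)] -/
theorem isHodgeMultiset_pair {m : ℕ} [NeZero m] {a : ZMod m} (ha : a ≠ 0) :
    IsHodgeMultiset ({a, -a} : Multiset (ZMod m)) := by
  have h := isHodgeMultiset_add_map_neg (Q := ({a} : Multiset (ZMod m))) (by simpa using ha)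
  simpa using h

end Summit.HodgeConjecture.HodgeConjecture.Theorems.CancelByAnyClaimLattice.Doubling
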